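import Summits.Parity.GeneralizedHardyLittlewood.Theorems.PrimeLevelFamEdgeMomentsBeyondDiagonalDiagDecorPrimePowPeelMixed
import HarnessLib

/-!
# Route `PrimeLevelFamEdge`, crux K_A `MomentsBeyondDiagonal` (stmt-Parity-20007), line «petersson_layers» v4, stub `stub_diag`:
# **the prime peels of the TRIPLE product decoration `P_m·P_{m′}·P_{m″}` and of `P_m·P_{m′}³`** — the peel identities of the
# quartic families `P₂²P₄`, `P₂⁴` of `M₈ = τ(105P₂⁴ − 420P₂²P₄ + 448P₂P₆ + 140P₄² − 272P₈)` (order `(4,4)` of `stub_diag`)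

Companions of `…DiagDecorPrimePowPeelMixed.sum_copTauW_mul_primePow_mul_primePow_eq`: peel the prime of `P_m` and split the
other factors on the support of `a_{np}(k′)` by `P_{m′}(pk′) = log^{m′}p + P_{m′}(k′)`
(`…DiagDecorPrimePowPeel.copTauW_mul_primePowSum_prime_mul`):

* `sum_copTauW_mul_primePow_triple_eq` — `Σ_k a_n(k)G(k)P_mP_{m′}P_{m″} = Σ_p log^{m+m′+m″}p·a(p)Σa_{np}G(pk′)
  + Σ_p log^{m+m′}p·a(p)Σa_{np}G(pk′)P_{m″}(k′) + Σ_p log^{m+m″}p·a(p)Σa_{np}G(pk′)P_{m′}(k′) + Σ_p log^m p·a(p)Σa_{np}G(pk′)P_{m′}P_{m″}(k′)`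
  (`P₂²P₄ = P₂·P₂·P₄`: `P₈`-peel + cross(`log⁴p`; `P₄`) + cross(`log⁶p`; `P₂`) + cross(`log²p`; `P₂P₄`));
* `sum_copTauW_mul_primePow_mul_primePow_cube_eq` — `Σ_k a_n(k)G(k)P_m·P_{m′}³ = Σ_p log^{m+3m′}p·(…) + 3Σ_p log^{m+2m′}p·(… P_{m′}(k′))
  + 3Σ_p log^{m+m′}p·(… P_{m′}(k′)²) + Σ_p log^m p·(… P_{m′}(k′)³)` (`P₂⁴ = P₂·P₂³`).

With the cross lemma `…DiagDecorCross.abs_decorCross_sub_le` and the landed inner families (`…PrimePowTwo` every `P_{2s}`,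
`…PrimeSqSq` `P₂²`, `…PrimeSqCube` `P₂³`, `…PrimeSqPrimeFourth` `P₂P₄`) these give `P₂²P₄ ↦ −9024` and `P₂⁴ ↦ −8000` in units
`c!/(c+6)!·E_n log^{c+6}y` (next bricks). Def-free; theorems only. Helper `--supports stmt-Parity-20007`; closes nothing; K_A, K_B
and the Parity summit are NOT proved; nothing about Landau–Siegel zeros.

## References
* E. Kowalski, P. Michel, J. VanderKam, J. reine angew. Math. 526 (2000), (23)–(28) pp. 13–15.
  [cite: KowalskiMichelVanderKam2000, (23)–(28) — derivation (prime decorations → prime sums)]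
-/

noncomputable section

open scoped Real
open Finset ArithmeticFunction

namespace Summit.Parity.GeneralizedHardyLittlewood.Theorems.MomentsBeyondDiagonal.DiagLines

open Literature.NumberTheory.LFunctions.KMV2000
open Summit.Parity.GeneralizedHardyLittlewood.Theorems.BeyondDiagonalBeatsQuarter.KernelFormXSq (copTauW)

/-- Pointwise split of two shifted decorations on the support of `a_{np}(k)` (`p` prime):
`a_{np}(k)·P_{m′}(pk)P_{m″}(pk) = a_{np}(k)·(log^{m′}p + P_{m′}(k))(log^{m″}p + P_{m″}(k))`. [folklore] -/
theorem copTauW_mul_primePowSum_prime_mul_two {p : ℕ} (hp : p.Prime) (n k m' m'' : ℕ) :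
    copTauW (n * p) k * ((∑ q ∈ (p * k).primeFactors, Real.log q ^ m') * ∑ q ∈ (p * k).primeFactors, Real.log q ^ m'') =
      copTauW (n * p) k * ((Real.log p ^ m' + ∑ q ∈ k.primeFactors, Real.log q ^ m') *
        (Real.log p ^ m'' + ∑ q ∈ k.primeFactors, Real.log q ^ m'')) := by
  have h1 := copTauW_mul_primePowSum_prime_mul hp n k m'
  have h2 := copTauW_mul_primePowSum_prime_mul hp n k m''
  calc copTauW (n * p) k * ((∑ q ∈ (p * k).primeFactors, Real.log q ^ m') * ∑ q ∈ (p * k).primeFactors, Real.log q ^ m'')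
      = (copTauW (n * p) k * ∑ q ∈ (p * k).primeFactors, Real.log q ^ m') *
          ∑ q ∈ (p * k).primeFactors, Real.log q ^ m'' := by ring
    _ = (Real.log p ^ m' + ∑ q ∈ k.primeFactors, Real.log q ^ m') *
          (copTauW (n * p) k * ∑ q ∈ (p * k).primeFactors, Real.log q ^ m'') := by rw [h1]; ring
    _ = _ := by rw [h2]; ring

/-- Pointwise split of a cubed shifted decoration on the support of `a_{np}(k)` (`p` prime):
`a_{np}(k)·P_{m′}(pk)³ = a_{np}(k)·(log^{m′}p + P_{m′}(k))³`. [folklore] -/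
theorem copTauW_mul_primePowSum_prime_mul_cube {p : ℕ} (hp : p.Prime) (n k m' : ℕ) :
    copTauW (n * p) k * (∑ q ∈ (p * k).primeFactors, Real.log q ^ m') ^ 3 =
      copTauW (n * p) k * (Real.log p ^ m' + ∑ q ∈ k.primeFactors, Real.log q ^ m') ^ 3 := by
  have h1 := copTauW_mul_primePowSum_prime_mul hp n k m'
  have h2 := copTauW_mul_primePowSum_prime_mul_two hp n k m' m'
  calc copTauW (n * p) k * (∑ q ∈ (p * k).primeFactors, Real.log q ^ m') ^ 3
      = (copTauW (n * p) k * ((∑ q ∈ (p * k).primeFactors, Real.log q ^ m') *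
          ∑ q ∈ (p * k).primeFactors, Real.log q ^ m')) * ∑ q ∈ (p * k).primeFactors, Real.log q ^ m' := by ring
    _ = ((Real.log p ^ m' + ∑ q ∈ k.primeFactors, Real.log q ^ m') *
          (Real.log p ^ m' + ∑ q ∈ k.primeFactors, Real.log q ^ m')) *
          (copTauW (n * p) k * ∑ q ∈ (p * k).primeFactors, Real.log q ^ m') := by rw [h2]; ring
    _ = _ := by rw [h1]; ring

/-- **The prime peel of a triple product decoration `P_m·P_{m′}·P_{m″}`** (see the module docstring).
[cite: KowalskiMichelVanderKam2000, (23)–(28) — derivation (prime decorations → prime sums)] -/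
theorem sum_copTauW_mul_primePow_triple_eq (n N m m' m'' : ℕ) (G : ℕ → ℝ) :
    ∑ k ∈ Icc 1 N, copTauW n k * G k *
        ((∑ q ∈ k.primeFactors, Real.log q ^ m) * ((∑ q ∈ k.primeFactors, Real.log q ^ m') *
          ∑ q ∈ k.primeFactors, Real.log q ^ m'')) =
      ∑ p ∈ (Icc 1 N).filter Nat.Prime, Real.log p ^ (m + m' + m'') * copTauW n p *
          ∑ k ∈ Icc 1 (N / p), copTauW (n * p) k * G (p * k) +
        ∑ p ∈ (Icc 1 N).filter Nat.Prime, Real.log p ^ (m + m') * copTauW n p *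
          ∑ k ∈ Icc 1 (N / p), copTauW (n * p) k * (G (p * k) * ∑ q ∈ k.primeFactors, Real.log q ^ m'') +
        ∑ p ∈ (Icc 1 N).filter Nat.Prime, Real.log p ^ (m + m'') * copTauW n p *
          ∑ k ∈ Icc 1 (N / p), copTauW (n * p) k * (G (p * k) * ∑ q ∈ k.primeFactors, Real.log q ^ m') +
        ∑ p ∈ (Icc 1 N).filter Nat.Prime, Real.log p ^ m * copTauW n p *
          ∑ k ∈ Icc 1 (N / p), copTauW (n * p) k * (G (p * k) *
            ((∑ q ∈ k.primeFactors, Real.log q ^ m') * ∑ q ∈ k.primeFactors, Real.log q ^ m'')) := by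
  have h := sum_copTauW_mul_mul_sum_primeFactors_eq n N
    (fun k ↦ G k * ((∑ q ∈ k.primeFactors, Real.log q ^ m') * ∑ q ∈ k.primeFactors, Real.log q ^ m''))
    (fun p ↦ Real.log p ^ m)
  have hl : ∑ k ∈ Icc 1 N, copTauW n k * G k *
      ((∑ q ∈ k.primeFactors, Real.log q ^ m) * ((∑ q ∈ k.primeFactors, Real.log q ^ m') *
        ∑ q ∈ k.primeFactors, Real.log q ^ m'')) =
      ∑ k ∈ Icc 1 N, copTauW n k *
        (G k * ((∑ q ∈ k.primeFactors, Real.log q ^ m') * ∑ q ∈ k.primeFactors, Real.log q ^ m'')) *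
        ∑ p ∈ k.primeFactors, Real.log p ^ m :=
    Finset.sum_congr rfl fun k _ ↦ by ring
  rw [hl, h, ← Finset.sum_add_distrib, ← Finset.sum_add_distrib, ← Finset.sum_add_distrib]
  refine Finset.sum_congr rfl fun p hp ↦ ?_
  have hp' : p.Prime := (Finset.mem_filter.1 hp).2
  rw [mul_assoc (Real.log p ^ (m + m' + m'')), mul_assoc (Real.log p ^ (m + m')) (copTauW n p),
    mul_assoc (Real.log p ^ (m + m'')) (copTauW n p), mul_assoc (Real.log p ^ m) (copTauW n p),
    mul_assoc (Real.log p ^ m) (copTauW n p),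
    Finset.mul_sum, Finset.mul_sum, Finset.mul_sum, Finset.mul_sum, Finset.mul_sum, Finset.mul_sum, Finset.mul_sum,
    Finset.mul_sum, Finset.mul_sum, Finset.mul_sum, ← Finset.sum_add_distrib, ← Finset.sum_add_distrib,
    ← Finset.sum_add_distrib]
  refine Finset.sum_congr rfl fun k _ ↦ ?_
  have hsplit := copTauW_mul_primePowSum_prime_mul_two hp' n k m' m''
  calc Real.log p ^ m * (copTauW n p * (copTauW (n * p) k * (G (p * k) *
        ((∑ q ∈ (p * k).primeFactors, Real.log q ^ m') * ∑ q ∈ (p * k).primeFactors, Real.log q ^ m''))))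
      = Real.log p ^ m * (copTauW n p * G (p * k)) *
          (copTauW (n * p) k * ((∑ q ∈ (p * k).primeFactors, Real.log q ^ m') *
            ∑ q ∈ (p * k).primeFactors, Real.log q ^ m'')) := by ring
    _ = Real.log p ^ m * (copTauW n p * G (p * k)) *
          (copTauW (n * p) k * ((Real.log p ^ m' + ∑ q ∈ k.primeFactors, Real.log q ^ m') *
            (Real.log p ^ m'' + ∑ q ∈ k.primeFactors, Real.log q ^ m''))) := by rw [hsplit]
    _ = _ := by rw [pow_add, pow_add, pow_add]; ring

/-- **The prime peel of the decoration `P_m·P_{m′}³`** (see the module docstring).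
[cite: KowalskiMichelVanderKam2000, (23)–(28) — derivation (prime decorations → prime sums)] -/
theorem sum_copTauW_mul_primePow_mul_primePow_cube_eq (n N m m' : ℕ) (G : ℕ → ℝ) :
    ∑ k ∈ Icc 1 N, copTauW n k * G k *
        ((∑ q ∈ k.primeFactors, Real.log q ^ m) * (∑ q ∈ k.primeFactors, Real.log q ^ m') ^ 3) =
      ∑ p ∈ (Icc 1 N).filter Nat.Prime, Real.log p ^ (m + 3 * m') * copTauW n p *
          ∑ k ∈ Icc 1 (N / p), copTauW (n * p) k * G (p * k) +
        3 * ∑ p ∈ (Icc 1 N).filter Nat.Prime, Real.log p ^ (m + 2 * m') * copTauW n p *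
          ∑ k ∈ Icc 1 (N / p), copTauW (n * p) k * (G (p * k) * ∑ q ∈ k.primeFactors, Real.log q ^ m') +
        3 * ∑ p ∈ (Icc 1 N).filter Nat.Prime, Real.log p ^ (m + m') * copTauW n p *
          ∑ k ∈ Icc 1 (N / p), copTauW (n * p) k * (G (p * k) * (∑ q ∈ k.primeFactors, Real.log q ^ m') ^ 2) +
        ∑ p ∈ (Icc 1 N).filter Nat.Prime, Real.log p ^ m * copTauW n p *
          ∑ k ∈ Icc 1 (N / p), copTauW (n * p) k * (G (p * k) * (∑ q ∈ k.primeFactors, Real.log q ^ m') ^ 3) := by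
  have h := sum_copTauW_mul_mul_sum_primeFactors_eq n N
    (fun k ↦ G k * (∑ q ∈ k.primeFactors, Real.log q ^ m') ^ 3) (fun p ↦ Real.log p ^ m)
  have hl : ∑ k ∈ Icc 1 N, copTauW n k * G k *
      ((∑ q ∈ k.primeFactors, Real.log q ^ m) * (∑ q ∈ k.primeFactors, Real.log q ^ m') ^ 3) =
      ∑ k ∈ Icc 1 N, copTauW n k * (G k * (∑ q ∈ k.primeFactors, Real.log q ^ m') ^ 3) *
        ∑ p ∈ k.primeFactors, Real.log p ^ m :=
    Finset.sum_congr rfl fun k _ ↦ by ring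
  rw [hl, h, Finset.mul_sum, Finset.mul_sum, ← Finset.sum_add_distrib, ← Finset.sum_add_distrib, ← Finset.sum_add_distrib]
  refine Finset.sum_congr rfl fun p hp ↦ ?_
  have hp' : p.Prime := (Finset.mem_filter.1 hp).2
  rw [mul_assoc (Real.log p ^ (m + 3 * m')), mul_assoc (Real.log p ^ (m + 2 * m')) (copTauW n p),
    mul_assoc (Real.log p ^ (m + m')) (copTauW n p), mul_assoc (Real.log p ^ m) (copTauW n p),
    mul_assoc (Real.log p ^ m) (copTauW n p),
    Finset.mul_sum, Finset.mul_sum, Finset.mul_sum, Finset.mul_sum, Finset.mul_sum, Finset.mul_sum, Finset.mul_sum,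
    Finset.mul_sum, Finset.mul_sum, Finset.mul_sum, Finset.mul_sum, Finset.mul_sum,
    ← Finset.sum_add_distrib, ← Finset.sum_add_distrib, ← Finset.sum_add_distrib]
  refine Finset.sum_congr rfl fun k _ ↦ ?_
  have hsplit := copTauW_mul_primePowSum_prime_mul_cube hp' n k m'
  calc Real.log p ^ m * (copTauW n p * (copTauW (n * p) k * (G (p * k) *
        (∑ q ∈ (p * k).primeFactors, Real.log q ^ m') ^ 3)))
      = Real.log p ^ m * (copTauW n p * G (p * k)) *
          (copTauW (n * p) k * (∑ q ∈ (p * k).primeFactors, Real.log q ^ m') ^ 3) := by ring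
    _ = Real.log p ^ m * (copTauW n p * G (p * k)) *
          (copTauW (n * p) k * (Real.log p ^ m' + ∑ q ∈ k.primeFactors, Real.log q ^ m') ^ 3) := by rw [hsplit]
    _ = _ := by rw [pow_add, pow_add, pow_add, pow_mul, pow_mul]; ring

end Summit.Parity.GeneralizedHardyLittlewood.Theorems.MomentsBeyondDiagonal.DiagLines

end
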